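import Literature.NumberTheory.Transcendental.AuxiliaryFunction
import Literature.NumberTheory.Transcendental.JetTransfer
import HarnessLib

/-!
# The first non-vanishing line jet of a form at a point of `M_κ`

Topic: `Literature/NumberTheory/Transcendental`. Plan item W4/S5(e1′) of the unit
`provefact-Literature.NumberTheory.Transcendental.H-b596640137`. At a point `w` with a valid
chart choice `c`, along a direction `x`, the form `F_P` factors near `ξ = 0` as
`F_P(w + ξx) = Θ_{J₀}(w + ξx)^D · (P ∘ H̃)(gens(ξ))` (`LineJetsBasic`, `LineODETheta`). PROVED here:

* `iteratedDeriv_thetaEval_line_eq` — if the line jets of `F_P` at `w` along `x` of orders `< k`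
  vanish, then the `k`-th one is `Θ_{J₀}(w)^D · ((D_x)^k (P ∘ H̃))(gens(w))` (`JetTransfer`);
* `iteratedDeriv_thetaEval_line_sum_eq` — for `x = ∑_m c_m x_m` this is
  `Θ_{J₀}(w)^D · ∑_ω (∏_t c_{ω t}) Λ_ω(P)` (word forms, `LineJetForms`);
* for the Baker data `B`, the point `s·v`, its chart `c_s` and `P = homog D (QOf ξ)`:
  `BakerData.lineValPoly` — the polynomial `p_{s,k} ∈ K[c_1, …, c_dd]`,
  `p_{s,k} = ∑_ω X^{content ω} · ∑_u ξ_u · entryVal s ω D (νOf u)`, with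
  `BakerData.degreeOf_lineValPoly_le` (`≤ k` in each variable) and
  `BakerData.extrapFun_grid_eq` — **`φ_{x_c,k}(s) = Θ_{J₀}(s·v)^D · emb(p_{s,k}(c))`** for
  `x_c = ∑ c_m x_m`, `c : Fin dd → ℕ`, whenever the lower line jets along `x_c` vanish;
* `BakerData.coeff_lineValPoly` — its coefficients are the Siegel-row combinations
  `∑_u ξ_u · rowSum D s k α (νOf u)`.

## References

* A. Baker, G. Wüstholz, *Logarithmic Forms and Diophantine Geometry*, CUP 2007, §6.8 (p. 119).
-/

noncomputable section

open Complex Filter Topology MvPolynomial Finset NumberField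
open scoped PeriodPair

namespace Literature.NumberTheory.Transcendental

namespace GaGmE

namespace Std

variable {β γ δ : Type} [Fintype β] [Fintype γ] [Fintype δ] [DecidableEq γ]
variable (L : PeriodPair) (κM : δ → γ → Kbar)

/-! ### The first non-vanishing line jet -/

/-- **The first non-vanishing line jet.** For a form `P` of degree `D`, a chart choice `c` valid
at `w` and a direction `x`: if the line jets of `F_P` at `w` along `x` of orders `< k` vanish, then
`d^k/dξ^k F_P(w + ξx)|₀ = Θ_{J₀}(w)^D · ((D_x)^k (P ∘ H̃))(gens(w))`.
[cite: BakerWustholz2007, §6.8 (p. 119: Ψ(s) = ϱ^δ ξ)] -/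
theorem iteratedDeriv_thetaEval_line_eq {P : MvPolynomial (Option β × ThetaIdx γ δ) ℂ} {D : ℕ}
    (hP : P.IsHomogeneous D) (c : γ → Bool) {w : β ⊕ (γ ⊕ δ) → ℂ} (x : β ⊕ (γ ⊕ δ) → ℂ)
    (hc : (0 : ℂ) ∈ chartDomain L c w x) {k : ℕ}
    (hlow : ∀ i < k, iteratedDeriv i (fun ξ : ℂ => thetaEval L κM P (w + ξ • x)) 0 = 0) :
    iteratedDeriv k (fun ξ : ℂ => thetaEval L κM P (w + ξ • x)) 0 =
      theta L κM (baseIdx c) w ^ D *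
        MvPolynomial.eval (genFun L κM c w x 0)
          ((PolyODE.der (genODE L κM c x))^[k] (MvPolynomial.bind₁ (HPoly L κM c) P)) := by
  -- `Θ_{J₀}(w) ≠ 0`
  have h0 : theta L κM (baseIdx c) w ≠ 0 := by
    rw [theta_baseIdx]
    refine Finset.prod_ne_zero_iff.mpr fun b _ => ?_
    have hv := hc b
    simp only [zero_mul, add_zero] at hv
    exact (factor_blocks (c b) hv 0).1
  -- the factorisation near `0`
  set g : ℂ → ℂ := fun ξ => theta L κM (baseIdx c) (w + ξ • x) ^ D with hg
  set E : ℂ → ℂ := fun ξ => MvPolynomial.eval (genFun L κM c w x ξ) (MvPolynomial.bind₁ (HPoly L κM c) P)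
    with hE
  have hgan : AnalyticAt ℂ g 0 := (analyticAt_theta_line L κM (baseIdx c) w x 0).pow D
  have hg0 : g 0 = theta L κM (baseIdx c) w ^ D := by simp [hg]
  have hopen := isOpen_chartDomain L c w x
  have hev : ∀ᶠ ξ in 𝓝 (0 : ℂ), ξ ∈ chartDomain L c w x := hopen.mem_nhds hc
  have hnear : ∀ᶠ ξ in 𝓝 (0 : ℂ), theta L κM (baseIdx c) (w + ξ • x) ≠ 0 := by
    have h0' : theta L κM (baseIdx c) (w + (0 : ℂ) • x) ≠ 0 := by simpa using h0
    exact (analyticAt_theta_line L κM (baseIdx c) w x 0).continuousAt.eventually_ne h0'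
  have hEeq : (fun ξ : ℂ => MvPolynomial.eval (fun J => chartCoord L κM (baseIdx c) J (w + ξ • x)) P)
      =ᶠ[𝓝 0] E := by
    filter_upwards [hev] with ξ hξ
    have hb : MvPolynomial.eval (genFun L κM c w x ξ) (MvPolynomial.bind₁ (HPoly L κM c) P) =
        MvPolynomial.eval (fun J => MvPolynomial.eval (genFun L κM c w x ξ) (HPoly L κM c J)) P :=
      MvPolynomial.eval₂Hom_bind₁ _ _ _ _
    have hfun : (fun J => chartCoord L κM (baseIdx c) J (w + ξ • x)) =
        fun J => MvPolynomial.eval (genFun L κM c w x ξ) (HPoly L κM c J) :=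
      funext fun J => chartCoord_baseIdx_eq_eval κM c w x hξ J
    show _ = MvPolynomial.eval (genFun L κM c w x ξ) (MvPolynomial.bind₁ (HPoly L κM c) P)
    rw [hb, hfun]
  have hEan : AnalyticAt ℂ E 0 := by
    have h0' : theta L κM (baseIdx c) (w + (0 : ℂ) • x) ≠ 0 := by simpa using h0
    exact (analyticAt_eval_chart_line L κM P (baseIdx c) w x h0').congr hEeq
  have hfac : (fun ξ : ℂ => thetaEval L κM P (w + ξ • x)) =ᶠ[𝓝 0] fun ξ => g ξ * E ξ := by
    filter_upwards [hnear, hEeq] with ξ hξ hξE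
    rw [thetaEval_eq_pow_mul_eval_chart L κM hP (baseIdx c) hξ, ← hξE]
  -- lower jets of `E` vanish
  have hlowE : ∀ i < k, iteratedDeriv i E 0 = 0 := by
    have hlow' : ∀ i < k, iteratedDeriv i (fun ξ => g ξ * E ξ) 0 = 0 := fun i hi => by
      rw [← hfac.iteratedDeriv_eq i]; exact hlow i hi
    exact (forall_iteratedDeriv_mul_eq_zero_iff hEan hgan (by rw [hg0]; exact pow_ne_zero _ h0) k).mp hlow'
  rw [iteratedDeriv_eq_mul_of_lowerJets_eq_zero hgan hEan hfac hlowE, hg0, hE,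
    iteratedDeriv_eval_genFun κM c w x _ k hc]

/-- **The first non-vanishing line jet along `x = ∑ c_m x_m`** is
`Θ_{J₀}(w)^D · ∑_ω (∏_t c_{ω t}) · Λ_ω(P)`. [folklore] -/
theorem iteratedDeriv_thetaEval_line_sum_eq {P : MvPolynomial (Option β × ThetaIdx γ δ) ℂ} {D : ℕ}
    (hP : P.IsHomogeneous D) (c : γ → Bool) {w : β ⊕ (γ ⊕ δ) → ℂ}
    (hc : ∀ x : β ⊕ (γ ⊕ δ) → ℂ, (0 : ℂ) ∈ chartDomain L c w x) {d : ℕ}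
    (xs : Fin d → β ⊕ (γ ⊕ δ) → ℂ) (cs : Fin d → ℂ) {k : ℕ}
    (hlow : ∀ i < k, iteratedDeriv i (fun ξ : ℂ => thetaEval L κM P (w + ξ • ∑ m, cs m • xs m)) 0 = 0) :
    iteratedDeriv k (fun ξ : ℂ => thetaEval L κM P (w + ξ • ∑ m, cs m • xs m)) 0 =
      theta L κM (baseIdx c) w ^ D *
        ∑ ω : Fin k → Fin d, (∏ t, cs (ω t)) * wordForm L κM c xs w ω P := by
  rw [iteratedDeriv_thetaEval_line_eq L κM hP c _ (hc _) hlow]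
  congr 1
  have hg : genFun L κM c w (∑ m, cs m • xs m) 0 = genFun L κM c w 0 0 := by
    funext i; rcases i with j | ⟨b, i⟩ | e <;> simp [genFun]
  rw [hg, der_genODE_sum_smul]
  set Dm : Fin d → MvPolynomial (Gen β γ δ) ℂ →ₗ[ℂ] MvPolynomial (Gen β γ δ) ℂ :=
    fun m => (PolyODE.der (genODE L κM c (xs m))).toLinearMap with hDm
  have hfun : (⇑(∑ m, cs m • PolyODE.der (genODE L κM c (xs m))) :
      MvPolynomial (Gen β γ δ) ℂ → MvPolynomial (Gen β γ δ) ℂ) = ⇑(∑ m, cs m • Dm m) := by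
    rw [Derivation.coe_sum_smul, LinearMap.coe_sum]
    exact Finset.sum_congr rfl fun m _ => by rw [LinearMap.coe_smul, hDm, Derivation.coeFn_coe]
  rw [hfun, PolyODE.iterate_sum_smul_apply, map_sum]
  refine Finset.sum_congr rfl fun ω _ => ?_
  rw [smul_eq_C_mul, map_mul, MvPolynomial.eval_C]
  rfl

/-! ### The Baker data: the polynomial `p_{s,k}` -/

namespace BakerData

variable {L κM}
variable [DecidableEq β] [DecidableEq δ] (B : BakerData β γ δ)

/-- The content of a word as a finitely supported function. [folklore] -/
def contentFs {k : ℕ} (ω : Fin k → Fin B.dd) : Fin B.dd →₀ ℕ :=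
  Finsupp.equivFunOnFinite.symm (PolyODE.content ω)

omit [DecidableEq β] [DecidableEq δ] in
/-- `contentFs ω m = content ω m`. [folklore] -/
@[simp] theorem contentFs_apply {k : ℕ} (ω : Fin k → Fin B.dd) (m : Fin B.dd) :
    B.contentFs ω m = PolyODE.content ω m := by
  simp [contentFs]

/-- **The polynomial `p_{s,k} ∈ K[c_1,…,c_dd]`** whose values at grid points are the normalised
line jets: `p_{s,k} = ∑_ω X^{content ω} · ∑_u ξ_u · entryVal s ω D (νOf u)` (`D = nD'`).
[cite: BakerWustholz2007, §6.8 (p. 119)] -/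
def lineValPoly {D' : ℕ} (ξ : UIdx β γ δ D' → 𝓞 B.K) (s k : ℕ) : MvPolynomial (Fin B.dd) B.K :=
  ∑ ω : Fin k → Fin B.dd, monomial (B.contentFs ω)
    (∑ u, (ξ u : B.K) * B.entryVal s ω (Fintype.card (β ⊕ (γ ⊕ δ)) * D') (νOf u))

/-- `deg_{c_m} p_{s,k} ≤ k`. [folklore] -/
theorem degreeOf_lineValPoly_le {D' : ℕ} (ξ : UIdx β γ δ D' → 𝓞 B.K) (s k : ℕ) (m : Fin B.dd) :
    (B.lineValPoly ξ s k).degreeOf m ≤ k := by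
  rw [lineValPoly, MvPolynomial.degreeOf_le_iff]
  intro α hα
  obtain ⟨ω, -, hω⟩ := Finset.mem_biUnion.mp (MvPolynomial.support_sum hα)
  have hsub := MvPolynomial.support_monomial_subset hω
  rw [Finset.mem_singleton] at hsub
  rw [hsub, contentFs_apply]
  exact PolyODE.content_le ω m

/-- The word forms of `P = homog D (QOf ξ)` at `s·v` are `emb(∑_u ξ_u · entryVal s ω D (νOf u))`.
[folklore] -/
theorem wordForm_homog_QOf {D' : ℕ} (ξ : UIdx β γ δ D' → 𝓞 B.K) (s : ℕ) {k : ℕ} (ω : Fin k → Fin B.dd) :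
    wordForm B.L B.κM (B.cAt s) B.xs ((s : ℂ) • B.v) ω
        (homog (Fintype.card (β ⊕ (γ ⊕ δ)) * D') (B.QOf ξ)) =
      B.emb (∑ u, (ξ u : B.K) * B.entryVal s ω (Fintype.card (β ⊕ (γ ⊕ δ)) * D') (νOf u)) := by
  rw [homog_QOf, wordForm_sum, map_sum]
  refine Finset.sum_congr rfl fun u _ => ?_
  rw [← smul_eq_C_mul, wordForm_smul, wordForm_homogMonomial, map_mul]

/-- **The coefficients of `p_{s,k}` are the content sums of word forms**: for a content
`α : Fin dd → ℕ`, `emb(coeff_α p_{s,k}) = ∑_{ω of content α} Λ_ω(P)` at `s·v`. [folklore] -/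
theorem emb_coeff_lineValPoly {D' : ℕ} (ξ : UIdx β γ δ D' → 𝓞 B.K) (s k : ℕ) (α : Fin B.dd → ℕ) :
    B.emb (coeff (Finsupp.equivFunOnFinite.symm α) (B.lineValPoly ξ s k)) =
      ∑ ω ∈ Finset.univ.filter (fun ω : Fin k → Fin B.dd => ∀ m, PolyODE.content ω m = α m),
        wordForm B.L B.κM (B.cAt s) B.xs ((s : ℂ) • B.v) ω
          (homog (Fintype.card (β ⊕ (γ ⊕ δ)) * D') (B.QOf ξ)) := by
  rw [lineValPoly, coeff_sum, map_sum, Finset.sum_filter]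
  refine Finset.sum_congr rfl fun ω _ => ?_
  rw [coeff_monomial]
  have hiff : (B.contentFs ω = Finsupp.equivFunOnFinite.symm α) ↔ ∀ m, PolyODE.content ω m = α m := by
    constructor
    · intro h m
      have := congrArg (fun f => f m) h
      simpa [contentFs] using this
    · intro h
      ext m
      simp [contentFs, h m]
  by_cases h : ∀ m, PolyODE.content ω m = α m
  · rw [if_pos (hiff.mpr h), if_pos h, wordForm_homog_QOf]
  · rw [if_neg (fun h' => h (hiff.mp h')), if_neg h, map_zero]

/-- **The normalised line jets at `s·v` along grid directions.** For `c : Fin dd → ℕ` and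
`x_c = ∑ c_m x_m`: if the line jets of `F_P` (`P = homog D (QOf ξ)`) at `s·v` along `x_c` of
orders `< k` vanish, then `φ_{x_c,k}(s) = Θ_{J₀(c_s)}(s·v)^D · emb(p_{s,k}(c))`.
[cite: BakerWustholz2007, §6.8 (p. 119)] -/
theorem iteratedDeriv_grid_eq {D' : ℕ} (ξ : UIdx β γ δ D' → 𝓞 B.K) (s k : ℕ) (cg : Fin B.dd → ℕ)
    (hlow : ∀ i < k, iteratedDeriv i (fun t : ℂ => thetaEval B.L B.κM
      (homog (Fintype.card (β ⊕ (γ ⊕ δ)) * D') (B.QOf ξ)) ((s : ℂ) • B.v + t • ∑ m, (cg m : ℂ) • B.xs m)) 0 = 0) :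
    iteratedDeriv k (fun t : ℂ => thetaEval B.L B.κM
        (homog (Fintype.card (β ⊕ (γ ⊕ δ)) * D') (B.QOf ξ)) ((s : ℂ) • B.v + t • ∑ m, (cg m : ℂ) • B.xs m)) 0 =
      theta B.L B.κM (baseIdx (B.cAt s)) ((s : ℂ) • B.v) ^ (Fintype.card (β ⊕ (γ ⊕ δ)) * D') *
        B.emb (MvPolynomial.eval (fun m => (cg m : B.K)) (B.lineValPoly ξ s k)) := by
  rw [iteratedDeriv_thetaEval_line_sum_eq B.L B.κM (isHomogeneous_homog _ _) (B.cAt s)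
    (fun x => zero_mem_chartDomain_chartChoiceAt B.L _ x) B.xs (fun m => (cg m : ℂ)) hlow]
  congr 1
  rw [lineValPoly, map_sum, map_sum]
  refine Finset.sum_congr rfl fun ω _ => ?_
  rw [MvPolynomial.eval_monomial, map_mul, wordForm_homog_QOf, mul_comm (B.emb _)]
  congr 1
  rw [Finsupp.prod_fintype _ _ (fun m => by simp), map_prod]
  simp only [contentFs_apply, map_pow, map_natCast]
  rw [PolyODE.prod_word_eq_prod_pow_content (fun m => (cg m : ℂ))]

end BakerData

end Std

end GaGmE

end Literature.NumberTheory.Transcendental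

end
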